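import Summits.AtomisticToContinuum.FouriersLaw.Theses.EmbeddedDrudeMourre
import Summits.AtomisticToContinuum.FouriersLaw.Theorems.DrudeDissolution.Negative.WeakAnharmonicityForm
import Summits.AtomisticToContinuum.FouriersLaw.Theorems.EmbeddedDrudeMourreMourreDissolutionSpectralWindow
import Summits.AtomisticToContinuum.FouriersLaw.Theorems.EmbeddedDrudeMourreFGRGap
import Literature.MathematicalPhysics.KineticTheory.ZeroWavenumberSpace
import Literature.MathematicalPhysics.KineticTheory.InfiniteChainInvariantStates
import Literature.MathematicalPhysics.KineticTheory.InfiniteChainSuperstableDynamics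
import Summits.AtomisticToContinuum.FouriersLaw.Theorems.EmbeddedDrudeMourreMourreDissolutionFrameworkReduction
import Summits.AtomisticToContinuum.FouriersLaw.Theorems.EmbeddedDrudeMourreDrudeDissolutionStubPencilFrameworkDynamics
import Summits.AtomisticToContinuum.FouriersLaw.Theorems.EmbeddedDrudeMourreDrudeDissolutionStubPencilFrameworkClustering
import Summits.AtomisticToContinuum.FouriersLaw.Theorems.EmbeddedDrudeMourreDrudeDissolutionStubPencilFrameworkDatum

/-!
# Stub F `stub_pencilFramework` of line `gram-pencil-harmonic-chaos`, crux
`EmbeddedDrudeMourre.DrudeDissolution` (stmt-AtomisticToContinuum-12593; `--supports` file, closes nothing)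

**The pencil's carrier: a rich symmetric zero-wavenumber datum whose observables are the
flow-orbit of the local polynomials, at unit temperature, for every `lam, β ≥ 0` — the harmonic
endpoint included.** For `ω₂ > 0`, `lam, β ≥ 0`: an infinite-volume dynamics `D` of
`pinnedChain ω₂ lam β 1` with `D.carrier = bmGood`, measurable flow, the identity off `bmGood`,
commuting EVERYWHERE with the lattice translations and with the spatial reflection `ι σ = σ(−·)`;
and a zero-wavenumber datum `Z` over `D` whose state is a DLR Gibbs state at `T = 1`, `ι`-invariant,
with momentum reversal a symmetry of the datum, strongly continuous Koopman group, and
`Z.localObs = span_ℝ {u ∘ φ_s : u ∈ 𝒫, s ∈ ℝ}`, `𝒫 = Algebra.adjoin ℝ {σ ↦ q_x, σ ↦ p_x}`.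

Assembly (this file, ≈ 30 lines) of the registered parts, all landed as `--supports` files of the
same item:

* F-a `pencilFramework_dynamics` (`…StubPencilFrameworkDynamics`): the canonical symmetric
  Buttà–Marchioro dynamics for the degree pattern `(σ₁, σ₂) ∈ {1,2}²` (`lam = 0 ∨ lam > 0`,
  `β = 0 ∨ β > 0`), with its exact `τ`/`R`/`ι` covariance;
* F-b `pencilFramework_clustering` (`…StubPencilFrameworkClustering`): the transfer-operator DLR state
  at `T = 1` (shift/`ι`-invariant, superstable) with `ℓ¹` space–time clustering of ALL local
  polynomials along the flow (box-`k` fixed-time `L²` locality `pencilFramework_localityA/B` +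
  exponential mixing) and continuity at `0` of the summed autocovariances;
* F-c `pencilFramework_datum` (`…StubPencilFrameworkDatum`): Doyon's datum on the span of the
  `𝒫`-orbit, momentum reversal, strong continuity from the generators.
-/

noncomputable section

namespace Summit.AtomisticToContinuum.FouriersLaw.Theorems.DrudeDissolution.GramPencilHarmonicChaos

open MeasureTheory Filter Set Function Topology
open scoped InnerProductSpace ENNReal
open Literature.MathematicalPhysics.KineticTheory
open Literature.MathematicalPhysics.KineticTheory.HeatConduction
open Literature.MathematicalPhysics.KineticTheory.PhononBoltzmann

/-- **STUB F** (L–XL; framework): the rich symmetric zero-wavenumber datum of `pinnedChain ω₂ lam β 1`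
(`lam, β ≥ 0`) at unit temperature, observables = flow-orbit of the local polynomials. For
`ω₂ > 0`, `lam, β ≥ 0`: the canonical symmetric Buttà–Marchioro dynamics `D` on `bmGood`
(identity off it, commuting everywhere with `τ_x` and `ι`) and Doyon's zero-wavenumber datum `Z`
over it — DLR state at `T = 1`, `ι`-invariant, momentum reversal a symmetry, strongly continuous
Koopman group — with `Z.localObs = span{u ∘ φ_s : u ∈ 𝒫}`. Assembly of the landed parts F-a
(`pencilFramework_dynamics`), F-b (`pencilFramework_clustering`), F-c (`pencilFramework_datum`).
[cite: ButtaMarchioro2016, §2 Thm 2.1–2.2 and §3] [cite: Doyon2022, §4.1 Def. 4.3–4.4, Thm 4.11] -/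
theorem stub_pencilFramework :
    ∀ ω₂ lam β : ℝ, 0 < ω₂ → 0 ≤ lam → 0 ≤ β →
      ∃ (D : InfiniteChainDynamics (pinnedChain ω₂ lam β 1))
        (Z : ZeroWavenumberData (pinnedChain ω₂ lam β 1) D),
          (pinnedChain ω₂ lam β 1).IsChainGibbsMeasure 1 Z.μ ∧
          D.carrier = (pinnedChain ω₂ lam β 1).bmGood ∧
          (∀ t : ℝ, Measurable (D.flow t)) ∧
          (∀ (t : ℝ) (σ : ChainConfig), σ ∉ (pinnedChain ω₂ lam β 1).bmGood → D.flow t σ = σ) ∧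
          (∀ (t : ℝ) (x : ℤ), D.flow t ∘ chainShift x = chainShift x ∘ D.flow t) ∧
          (∀ t : ℝ, (fun (σ : ChainConfig) (i : ℤ) => σ (-i)) ∘ D.flow t = D.flow t ∘ (fun (σ : ChainConfig) (i : ℤ) => σ (-i))) ∧
          MeasureTheory.MeasurePreserving (fun (σ : ChainConfig) (i : ℤ) => σ (-i)) Z.μ Z.μ ∧
          Z.HasMomentumReversal ∧
          Z.toFluctuationDynamics.IsStronglyContinuous ∧
          Z.localObs = Submodule.span ℝ {w : ChainConfig → ℝ | ∃ u ∈ Algebra.adjoin ℝ (Set.range fun xc : ℤ × Bool => fun σ : ChainConfig => if xc.2 then (σ xc.1).2 else (σ xc.1).1), ∃ s : ℝ, w = u ∘ D.flow s} := by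
  intro ω₂ lam β hω hl hβ
  -- F-a: the canonical symmetric dynamics
  obtain ⟨D, hD, hm, hid, hgrp, hpresAll, hsh, hrev, hrefl⟩ := pencilFramework_dynamics ω₂ lam β 1 hω hl hβ
  -- F-b: the clustering thermal state at `T = 1`
  obtain ⟨μ, hG, hshift, hSS, hιmap, hsum, hcont⟩ :=
    pencilFramework_clustering ω₂ lam β 1 hω hl hβ 1 one_pos D hD hm hid
  haveI := hG.isProbabilityMeasure
  have hpres : D.PreservesMeasure μ := hpresAll 1 μ hG hSS
  -- global `φ_0 = id` and group law (identity off `bmGood`)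
  have h0 : D.flow 0 = id := by
    funext σ
    by_cases hσ : σ ∈ (pinnedChain ω₂ lam β 1).bmGood
    · exact D.flow_zero σ (by rw [hD]; exact hσ)
    · exact hid 0 σ hσ
  have hgrp' : ∀ t s : ℝ, D.flow (t + s) = D.flow t ∘ D.flow s := by
    intro t s
    funext σ
    by_cases hσ : σ ∈ (pinnedChain ω₂ lam β 1).bmGood
    · exact hgrp t s σ hσ
    · rw [comp_apply, hid (t + s) σ hσ, hid s σ hσ, hid t σ hσ]
  -- F-c: the rich datum
  obtain ⟨Z, hZμ, hMR, hsc, hobs⟩ :=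
    pencilFramework_datum ω₂ lam β 1 D h0 hgrp' hsh hrev μ hpres (hshift.measurePreserving_chainShift)
      (MourreDissolution.measurePreserving_chainReversal_of_isChainGibbsMeasure hG)
      (fun u hu => (moments_of_mem_polyObs 1 hω hl hβ one_pos hG hshift hu).2.1) hsum hcont
  refine ⟨D, Z, by rw [hZμ]; exact hG, hD, hm, hid, hsh, hrefl, ?_, hMR, hsc, hobs⟩
  rw [hZμ]
  exact ⟨MourreDissolution.measurable_reflect, hιmap⟩

end Summit.AtomisticToContinuum.FouriersLaw.Theorems.DrudeDissolution.GramPencilHarmonicChaos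

end
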